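import Literature.MathematicalPhysics.QuantumFieldTheory.Balaban1983to89.Node00.Record13
import HarnessLib

/-!
# BalabanLadder ∕ UV — Track A's output ONE LINE BEFORE the Stage-0 projection, as two named packages at NODE 00's Stage-13 record

OS-ASSEMBLY BOOKKEEPING (cell `ym-fleet`, seat `ym-osasm-p1`, director-ym R136 (iii); `--supports stmt-QuantumFields-19351` = the spine crux
`Summit.QuantumFields.YangMills.Theses.BalabanLadder.UV`, binder `hUV` of `BalabanLadder.closes`).  DEFINITIONS ONLY (two `Prop`s, parametric in the
group rank `N`); nothing of Bałaban's is asserted; COUNT-NEUTRAL.  The Stage-13 twin of `Theorems/BalabanLadderUVRecord12Defs.lean` (p468625): SAME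
shapes, tokens re-keyed `₁₂ ↦ ₁₃` exactly as the detail route's announced rev 16 re-keys its four items (director-ym LINE №125 (3); plan kit
`D65-REV16/map16.json`: tuple type `Node00.Stage13Params` = `Stage12Params` + the (2.9) threshold letter, provisos `θ.Provisos₁₃ F N`, present-slot
non-degeneracy `θ.SlotsNondegenerate₁₃ F N` (now with `F N` explicit), partition of unity `θ.ZtUnity F N` (the Stage-12 predicate, reached through
`extends`), admissibility `θ.Admissible F N`, datum `Node00.datumOfRecord₁₃ F N θ h`, record class `Node00.IsRecordOfRecord₁₃C`).

WHY.  RECORD 13 (`Node00/Record13.lean`: def-T g7 p486037, v1.1 IN PLACE p488788 = the `bg` row keyed to def-R's ranged `BgProvisoΛ` + the (2.9)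
letter renamed `ε₂₉`; the interface names used below are unchanged) is the successor record the Track-A detail route `route-QuantumFields-BalabanUVNodes`
re-keys to at rev 16 (HELD until v1.1 by director-ym LINE №131; released by its landing): its deciding theorem becomes
`closes (h0 : Record13Inhabited) (h1 : StabilityBAtRecordR13e) (h2 : EndpointGivenBR13) (h3 : SpineGivenEndpointR13) : BalabanLadder.UV` with the rev-15 proof
and `datumOfRecord₁₂ ↦ datumOfRecord₁₃` (the leaf reads only `Node00.IsDatumOfRecord₀`, `rfl` at Stage 13 as at Stage 12).  Every consumer that needs the
PINNED record rather than a Stage-0 datum — the E1 restate of `UV` (R85 item 1: «the E1 text must name the record Track A's `closes` concludes BY NAME»,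
owner RULING R25 [R1]), E0′ = `UVSeamRec.stub_ceilings`, the SU(N) apex `UVApexSUN` in spelling (θ), the infinite-volume programme's `UVCond` — wants
the conjunction `closes` holds one line before the projection.  This file NAMES it at Stage 13, once, in the two currencies in use:

* `UVAtParams13 N` — θ-keyed (the route's rev-16 currency): `∀ F, ∃ θ h, (ZtUnity ∧ SlotsNondegenerate₁₃) ∧ Admissible ∧ (B) ∧ window(K ≥ 1) ∧ END ∧ NE7`
  at `Node00.datumOfRecord₁₃ F N θ h`;
* `UVAtRecord13C N` — (D, w)-keyed: `∀ F, ∃ D w, Node00.IsRecordOfRecord₁₃C F N D w ∧ (B) ∧ window(K ≥ 1) ∧ END ∧ NE7`.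

The kernels (`Theorems/BalabanLadderUVRecord13.lean`) prove: the four rev-16 texts (with `2 ↦ N`, INLINE) ⇒ `UVAtParams13 N`; `UVAtParams13 N ⇒
UVAtRecord13C N` (`Node00.exists_world_isRecordOfRecord₁₃C`); both ⇒ the Stage-0 text (= the body of `YMDAG.UVSplit.UVD59 N`, at `N = 2` the CURRENT body
of `BalabanLadder.UV`: consumers close those goals by `exact`, definitional unfolding); the T⁴ apex and its law-reading AT the pinned record.
ROUTE-INDEPENDENT BY DESIGN (standing build rule 2026-08-26T18:55Z): neither module imports a `Theses` file or a module in a route's cone, so no route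
edit (Track A's rev 16, the spine's R85 restate of `UV`) can break them; under a θ-pinned E1 text `UV := <UVAtParams13 2>` the θ-package IS the new
leaf and `stage0_of_uvAtParams13` is the one-direction tether `UV → UVD59 2` the Stage-0 consumers re-point to (R85 rev 3h Δ14 (a)).  HONEST FRAMING:
names for HYPOTHESES of a conditional chain (0∕6 spine legs discharged); one finite four-torus programme per family at fixed ε; NOT infinite volume,
NOT OS on ℝ⁴, NOT a mass gap, NOT Clay.
-/

set_option autoImplicit false

namespace Summit.QuantumFields.YangMills.Cruxes.UV.Record13

open Literature.MathematicalPhysics.QuantumFieldTheory.Balaban1983to89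
open Literature.MathematicalPhysics.QuantumFieldTheory.Balaban1983to89.T4Continuum

/-- **TRACK A's UV PACKAGE AT THE PINNED STAGE-13 RECORD, θ-KEYED** (`SU(N)`; the spine's is `N = 2`): on every four-torus family some admissible
Stage-13 parameter tuple `θ` satisfying its displayed provisos `h`, with print's partition of unity and non-degenerate present slots (torus-guarded),
whose datum of record `Node00.datumOfRecord₁₃ F N θ h` carries [III]'s end statement (B) as printed, the non-vacuity coupling window with `K ≥ 1`,
endpoint existence of its coupling flow ([I] Thm 2, endpoint half) and the hybrid-NE7 spine under it.  Verbatim the conjunction the detail route's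
rev-16 `closes` holds after feeding K1‴'s record to K2‴ and K3‴ and before projecting to Stage 0.  OPEN as a whole; never asserted. -/
def UVAtParams13 (N : ℕ) [NeZero N] : Prop :=
  ∀ F : T4Family, ∃ (θ : Node00.Stage13Params F N) (h : θ.Provisos₁₃ F N),
    (θ.ZtUnity F N ∧ θ.SlotsNondegenerate₁₃ F N) ∧ θ.Admissible F N ∧
    B16.EndStatementBPrinted (Node00.datumOfRecord₁₃ F N θ h).C ∧
    (∃ γ₁ : ℝ, 0 < γ₁ ∧ ∀ γ : ℝ, 0 < γ → γ ≤ γ₁ →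
      ∃ P : B12.RunParams, 1 ≤ P.K ∧ ((Node00.datumOfRecord₁₃ F N θ h).C P).flow.InInterval γ P.K) ∧
    DagBinding.EndpointExistence (Node00.datumOfRecord₁₃ F N θ h).C.toB12 ∧
    T4ApexHybrid.HybridNE7Under (Node00.datumOfRecord₁₃ F N θ h)
      (DagBinding.EndpointExistence (Node00.datumOfRecord₁₃ F N θ h).C.toB12)

/-- **TRACK A's UV PACKAGE AT A STAGE-13 RECORD-OF-RECORD, (D, w)-KEYED** (`SU(N)`): on every four-torus family some finite-ε datum `D` and world
`w` with `Node00.IsRecordOfRecord₁₃C F N D w` («(D, w) is the record, Stage 13»: `D = datumOfRecord₁₃ θ h` for admissible θ with provisos, `w` bound to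
its construction), carrying (B) as printed, the `K ≥ 1` coupling window, endpoint existence and the hybrid-NE7 spine.  Implied by `UVAtParams13 N`
(the unity ∕ non-degeneracy clause is dropped — the record predicate does not carry it).  OPEN as a whole; never asserted. -/
def UVAtRecord13C (N : ℕ) [NeZero N] : Prop :=
  ∀ F : T4Family, ∃ (D : FiniteEpsData F (Matrix.specialUnitaryGroup (Fin N) ℂ)) (w : DagBinding.WorldP),
    Node00.IsRecordOfRecord₁₃C F N D w ∧ B16.EndStatementBPrinted D.C ∧
    (∃ γ₁ : ℝ, 0 < γ₁ ∧ ∀ γ : ℝ, 0 < γ → γ ≤ γ₁ → ∃ P : B12.RunParams, 1 ≤ P.K ∧ (D.C P).flow.InInterval γ P.K) ∧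
    DagBinding.EndpointExistence D.C.toB12 ∧
    T4ApexHybrid.HybridNE7Under D (DagBinding.EndpointExistence D.C.toB12)

end Summit.QuantumFields.YangMills.Cruxes.UV.Record13
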